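import Summits.BirchSwinnertonDyer.BirchSwinnertonDyer.Theorems.AlignedTransportAtTwoMainConjectureOfRankZeroBSDAtTwoSelmerLayerControl
import Summits.BirchSwinnertonDyer.BirchSwinnertonDyer.Theorems.AlignedTransportAtTwoMainConjectureOfRankZeroBSDAtTwoSelmerLayerModelAtTwo
import Literature.NumberTheory.EllipticCurves.IwasawaAlgebraGenericSpecializationRankProofs
import Literature.NumberTheory.EllipticCurves.IwasawaSelmerControlOfLayerKernelsProofs
import Literature.NumberTheory.EllipticCurves.IwasawaSelmerIsTorsionProofs
import HarnessLib

/-!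
# Route `AlignedTransportAtTwo`, crux C2 `MainConjectureOfRankZeroBSDAtTwo` (stmt-BirchSwinnertonDyer-22298):
# THE TWO-SIDED LAYER-ONE MATCHING — `rank_{ℤ₂} X/(T+2)X = corank_{ℤ₂} Sel_{2^∞}(W⁽²⁾/ℚ)` MODULO EXACTLY
# GREENBERG'S LEMMA 3.4 AT THE LAYER `n = 1`; UNCONDITIONALLY `≥`, and the involution split
# `corank Sel_∞^{γ²} = corank Sel_∞^{γ} + corank Sel_∞^{γ = −1}` with `corank Sel_∞^{γ = −1} = rank_{ℤ₂} X/(T+2)X`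

HONEST FRAMING (cell `bsd-f1-sign2`, WIDTH-5 attached prover seat `bsd-line-att-p5` gen 40 on line `birth` of the lead
`bsd-line-att-p2`; `--supports` stmt-BirchSwinnertonDyer-22298, closes nothing; BSD is NOT proved by any of this; the crux
C2, its verdict «blocked-on `Rank1Residual.GreenbergMuConjectureIrreducible`» and every registered stub are untouched).
THEOREMS ONLY — no `def`, no instance, no NEW named fact, no `sorry`; ONE theorem (§3, `…_of_lemma34`) is CONDITIONAL on the
tree's existing named print fact `Greenberg1999.lemma34_natCard_localTowerKerPrimary_eq_rat` (Greenberg, LNM 1716, Lemma 3.4 for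
`F = ℚ`), displayed as a hypothesis.

The lineage (g38 `…TwistReading`, g39 `…SelmerLayerModelAtTwo`) has the ONE-SIDED layer-one matching
`corank Sel_{2^∞}(W⁽²⁾/ℚ) ≤ ord_{T=−2}` / `(T+2)^{corank} ∣ f_X` and recorded (g38 NET (4), g39 §2 item 4) that the converse needs
control at layer `1` in corank form. With `…SelmerLayerDuality` / `…SelmerLayerControl` (this gen) the picture at `p = 2` is:

* §1 (any number field, any `ℤ₂`-extension `κ` with topological generator `γ`, `X` finitely generated; `φ = conj_γ|_{Sel_∞}`):
  `finite_torsionBy_endInvariants_of_smul`; ★★ `zpCorank_endInvariants_sq_sub_one_eq_add` —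
  **`corank ker(φ² − 1) = corank ker(φ − 1) + corank ker(φ + 1)`** (the map `(a, b) ↦ a + b` has kernel and cokernel killed
  by `2`: `2s = (s + φs) + (s − φs)`); `toDual_X_add_two_smul` — `T + 2` acts as `φ + 1`; ★★ `zpCorank_endInvariants_add_one_eq_lambdaInvariant`
  — **`corank ker(φ + 1) = rank_{ℤ₂} X/(T+2)X`**; ★★ `zpCorank_selmerInvariants_one_eq_coinvariantsRank_add` —
  **`corank Sel_∞^{Γ_1} = rank_{ℤ₂} X/TX + rank_{ℤ₂} X/(T+2)X`** (so `rank X/ω₁X = rank X/TX + rank X/(T+2)X`, the CRT count, without CRT).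
* §2 (`K = ℚ`, `W` globally minimal, good ordinary at `2`, `κ` cyclotomic): ★★ `selmerCorank_quadraticTwist_le_lambdaInvariant_quotient_X_add_two`
  — **`corank Sel_{2^∞}(W⁽²⁾/ℚ) ≤ rank_{ℤ₂} X/(T+2)X` UNCONDITIONALLY** (g39's `zpCorank_selmerLayer_one_eq_add` = DD 4.14, layer-0
  control `Greenberg1999_coinvariantsRank_eq_selmerCorank_rat_holds`, Lemma 3.1 at layer 1); ★★★
  `lambdaInvariant_quotient_X_add_two_eq_selmerCorank_quadraticTwist_of_finite_kerG` — **EQUALITY as soon as `ker g_1` is finite**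
  (`…_of_finite_cokerS` likewise).
* §3 ★★★ `lambdaInvariant_quotient_X_add_two_eq_selmerCorank_quadraticTwist_of_lemma34` — **EQUALITY modulo the named fact
  Lemma 3.4 (`F = ℚ`)** through `selmer_control_of_lemma34`; so the two-sided matching is EXACTLY as conditional as Mazur's
  control theorem over `ℚ` at the single layer `n = 1`, i.e. on the finiteness of
  `𝒦_{v,1}[2^∞] = ker(H¹(ℚ₂(√2), E) → H¹(ℚ_{2,∞}, E))[2^∞]` (localisation: `…SelmerLayerControlLocal`).

References: R. Greenberg, LNM 1716 (1999), Thm. 1.2, §1 pp. 60–65, §3 Lemmas 3.1–3.5 (pp. 86–90) [GreenbergLNM1716];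
T. Dokchitser, V. Dokchitser, Ann. of Math. 172 (2010), Lemma 4.14 [DokchitserDokchitserAnnals2010]; B. Mazur, Invent. Math. 18
(1972), §6 [Mazur1972]; L. Washington, GTM 83, §13.2 (Prop. 13.8) [Washington1997].
-/

set_option linter.dupNamespace false
set_option autoImplicit false

noncomputable section

open scoped Classical AddSubgroup TensorProduct

universe u

namespace Summit.BirchSwinnertonDyer.BirchSwinnertonDyer.Theorems.AlignedTransportAtTwoSelmerLayerTwoSidedMatching

open WeierstrassCurve Literature.NumberTheory.EllipticCurves Literature.NumberTheory.EllipticCurves.IwasawaDual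
  Summit.BirchSwinnertonDyer.BirchSwinnertonDyer.Theorems.AlignedTransportAtTwoSelmerLayerModel
  Summit.BirchSwinnertonDyer.BirchSwinnertonDyer.Theorems.AlignedTransportAtTwoSelmerLayerDuality
  Summit.BirchSwinnertonDyer.BirchSwinnertonDyer.Theorems.AlignedTransportAtTwoSelmerLayerControl
  Summit.BirchSwinnertonDyer.BirchSwinnertonDyer.Theorems.AlignedTransportAtTwoSelmerLayerModelAtTwo

/-! ## §1 The involution split, as pure algebra -/

section Generic

variable {S : Type u} [AddCommGroup S] (φ : AddMonoid.End S)

/-- `a ∈ ker(φ − 1)`, `b ∈ ker(φ + 1)` ⟹ `a + b ∈ ker(φ² − 1)`. [folklore] -/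
theorem add_mem_endInvariants_sq_sub_one {a b : S} (ha : a ∈ endInvariants (φ - 1)) (hb : b ∈ endInvariants (φ + 1)) :
    a + b ∈ endInvariants (φ ^ 2 - 1) := by
  rw [mem_endInvariants_iff] at ha hb ⊢
  change φ a - a = 0 at ha
  change φ b + b = 0 at hb
  change φ (φ (a + b)) - (a + b) = 0
  rw [sub_eq_zero] at ha
  rw [add_eq_zero_iff_eq_neg] at hb
  rw [map_add, map_add, ha, hb, map_neg, hb, neg_neg, ha, sub_self]

/-- **The involution split: `corank ker(φ² − 1) = corank ker(φ − 1) + corank ker(φ + 1)`** for an endomorphism `φ` of a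
`2`-primary abelian group whose three kernels have finite `2`-torsion: the sum map `ker(φ − 1) × ker(φ + 1) → ker(φ² − 1)`
has kernel killed by `2` (`a = −b` is fixed and anti-fixed) and cokernel killed by `2` (`2s = (s + φs) + (s − φs)`), hence
preserves coranks (`zpCorank_eq_of_nsmul_ker_of_nsmul_coker`, `zpCorank_prod`).
[cite: DokchitserDokchitserAnnals2010, Lemma 4.14 (proof: kernel and cokernel killed by |G|)] -/
theorem zpCorank_endInvariants_sq_sub_one_eq_add_of_primary (hS : ∀ s : S, ∃ k : ℕ, 2 ^ k • s = 0)
    [Finite (↥(endInvariants (φ - 1)))[(2 : ℤ)]] [Finite (↥(endInvariants (φ + 1)))[(2 : ℤ)]]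
    [Finite (↥(endInvariants (φ ^ 2 - 1)))[(2 : ℤ)]] :
    zpCorank ↥(endInvariants (φ ^ 2 - 1)) 2 =
      zpCorank ↥(endInvariants (φ - 1)) 2 + zpCorank ↥(endInvariants (φ + 1)) 2 := by
  have hP : ∀ (g : AddMonoid.End S) (s : ↥(endInvariants g)), ∃ k : ℕ, 2 ^ k • s = 0 := fun g s ↦ by
    obtain ⟨k, hk⟩ := hS (s : S)
    exact ⟨k, Subtype.ext (by rw [AddSubgroupClass.coe_nsmul, hk]; rfl)⟩
  have mem0 : ∀ s : S, s ∈ endInvariants (φ - 1) ↔ φ s = s := fun s ↦ by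
    rw [mem_endInvariants_iff]; change φ s - s = 0 ↔ _; exact sub_eq_zero
  have memB : ∀ s : S, s ∈ endInvariants (φ + 1) ↔ φ s = -s := fun s ↦ by
    rw [mem_endInvariants_iff]; change φ s + s = 0 ↔ _; exact add_eq_zero_iff_eq_neg
  have mem1 : ∀ s : S, s ∈ endInvariants (φ ^ 2 - 1) ↔ φ (φ s) = s := fun s ↦ by
    rw [mem_endInvariants_iff]; change φ (φ s) - s = 0 ↔ _; exact sub_eq_zero
  -- the sum map
  let sm : (↥(endInvariants (φ - 1)) × ↥(endInvariants (φ + 1))) →+ ↥(endInvariants (φ ^ 2 - 1)) :=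
    { toFun := fun ab ↦ ⟨(ab.1 : S) + ab.2, add_mem_endInvariants_sq_sub_one φ ab.1.2 ab.2.2⟩
      map_zero' := Subtype.ext (by change (0 : S) + 0 = 0; rw [add_zero])
      map_add' := fun ab cd ↦ Subtype.ext (by
        change ((ab.1 : S) + cd.1) + ((ab.2 : S) + cd.2) = ((ab.1 : S) + ab.2) + ((cd.1 : S) + cd.2)
        abel) }
  have hsm : ∀ ab, ((sm ab : ↥(endInvariants (φ ^ 2 - 1))) : S) = (ab.1 : S) + ab.2 := fun _ ↦ rfl
  -- the product is `2`-primary with finite `2`-torsion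
  obtain ⟨hPprod, hfinprod⟩ := primary_and_finite_torsionBy_of_shortExact
    (i := AddMonoidHom.inl ↥(endInvariants (φ - 1)) ↥(endInvariants (φ + 1)))
    (f := AddMonoidHom.snd ↥(endInvariants (φ - 1)) ↥(endInvariants (φ + 1)))
    (fun a b h ↦ (Prod.ext_iff.mp h).1)
    (fun x hx ↦ ⟨x.1, Prod.ext rfl (by change (0 : ↥(endInvariants (φ + 1))) = x.2; exact (hx : x.2 = 0).symm)⟩)
    (fun _ ↦ rfl) (hP _) (hP _)
  haveI := hfinprod
  -- kernel killed by `2`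
  have hker : ∀ ab, sm ab = 0 → (2 : ℕ) • ab = 0 := by
    rintro ⟨a, b⟩ hab
    have hab' : (a : S) + b = 0 := congrArg Subtype.val hab
    have ha : φ a = (a : S) := (mem0 _).mp a.2
    have hb : φ b = -(b : S) := (memB _).mp b.2
    have hab'' : (a : S) = -b := eq_neg_of_add_eq_zero_left hab'
    have h2a : (a : S) + a = 0 := by
      nth_rw 2 [← ha]
      rw [hab'', map_neg, hb, neg_neg, neg_add_cancel]
    have h2b : (b : S) + b = 0 := by
      have : (b : S) = -a := by rw [hab'', neg_neg]
      rw [this, ← neg_add, h2a, neg_zero]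
    refine Prod.ext (Subtype.ext ?_) (Subtype.ext ?_)
    · change ((2 : ℕ) • a : ↥(endInvariants (φ - 1))).1 = 0
      rw [AddSubgroupClass.coe_nsmul, two_nsmul]; exact h2a
    · change ((2 : ℕ) • b : ↥(endInvariants (φ + 1))).1 = 0
      rw [AddSubgroupClass.coe_nsmul, two_nsmul]; exact h2b
  -- cokernel killed by `2`
  have hcoker : ∀ s : ↥(endInvariants (φ ^ 2 - 1)), (2 : ℕ) • s ∈ sm.range := by
    intro s
    have hs : φ (φ (s : S)) = s := (mem1 _).mp s.2
    refine ⟨(⟨(s : S) + φ s, (mem0 _).mpr (by rw [map_add, hs, add_comm])⟩,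
      ⟨(s : S) - φ s, (memB _).mpr (by rw [map_sub, hs, neg_sub])⟩), Subtype.ext ?_⟩
    rw [hsm, AddSubgroupClass.coe_nsmul, two_nsmul]
    change ((s : S) + φ s) + ((s : S) - φ s) = (s : S) + s
    abel
  have key := zpCorank_eq_of_nsmul_ker_of_nsmul_coker sm hPprod (hP _) (N := 2) two_ne_zero hker hcoker
  rw [← key, zpCorank_prod (hP _) (hP _)]

end Generic

/-! ## §1b The split on `Sel_∞` and Pontryagin at `T + 2` -/

section SplitTwo

variable {K : Type u} [Field K] [NumberField K] (W : WeierstrassCurve K) {p : ℕ} [Fact p.Prime]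
  (κ : ZpExtension K p) {γ : Field.absoluteGaloisGroup K}

/-- **`ker g ⊆ Sel_∞` has finite `p`-torsion whenever `f ∈ Λ` acts on `X` as `g` and `Λ/(f)` is `ℤ_p`-finite** (`X` finitely
generated): Pontryagin `X/fX ≃+ Hom(ker g, ℚ/ℤ)` and `…SelmerLayerDuality.finite_torsionBy_of_addEquiv_characterModule`.
[cite: GreenbergLNM1716, §1 p. 60] -/
theorem finite_torsionBy_endInvariants_of_smul (hγ : κ.IsTopGenerator γ) (D : W.SelmerDualData κ γ)
    [Module.Finite (IwasawaAlgebra p) D.X] {f : IwasawaAlgebra p} {g : AddMonoid.End (W.selmerInfty κ)}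
    (hfg : ∀ (x : D.X) (s : W.selmerInfty κ), D.toDual (f • x) s = D.toDual x (g s))
    (hf : Module.Finite ℤ_[p] (IwasawaAlgebra p ⧸ Ideal.span {f})) : Finite (↥(endInvariants g))[(p : ℤ)] := by
  obtain ⟨Ψ, -⟩ := (D.isDualPair W hγ).exists_quotient_addEquiv_of_smul hfg
  letI : Module ℤ_[p] (D.X ⧸ (Ideal.span {f} • ⊤ : Submodule (IwasawaAlgebra p) D.X)) :=
    Module.compHom _ (algebraMap ℤ_[p] (IwasawaAlgebra p))
  haveI : Module.Finite ℤ_[p] (D.X ⧸ (Ideal.span {f} • ⊤ : Submodule (IwasawaAlgebra p) D.X)) :=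
    module_finite_int_quotient p (Ideal.span {f}) hf
  exact finite_torsionBy_of_addEquiv_characterModule p Ψ

/-- **`T + 2` acts on `X` as `φ + 1` on `Sel_∞`** (`T` acts as `φ − 1`, `2` as `2`): the Pontryagin pair of the order-2
character of the layer `K_1/K`. [cite: GreenbergLNM1716, §1 p. 60 (`T = γ − 1`)] -/
theorem toDual_X_add_two_smul (hγ : κ.IsTopGenerator γ) (D : W.SelmerDualData κ γ) (x : D.X) (s : W.selmerInfty κ) :
    D.toDual ((PowerSeries.X + 2 : IwasawaAlgebra p) • x) s = D.toDual x ((W.conjSelmerInfty κ γ + 1) s) := by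
  rw [add_smul, map_add, AddMonoidHom.add_apply, (D.isDualPair W hγ).T_smul, End_sub_apply, AddMonoid.End.one_apply,
    map_sub, two_smul, map_add, AddMonoidHom.add_apply]
  change D.toDual x (W.conjSelmerInfty κ γ s) - D.toDual x s + (D.toDual x s + D.toDual x s) =
    D.toDual x (W.conjSelmerInfty κ γ s + s)
  rw [map_add]; abel

/-- `Λ/(T + 2)` is a finitely generated `ℤ₂`-module (free of rank one: `T + 2 = T − (−2)`, `−2 ∈ 𝔪`;
`IwasawaAlgebra.free_finrank_quotient_X_sub_C`). [cite: Washington1997, Prop. 13.8] -/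
theorem module_finite_int_quotient_X_add_two :
    Module.Finite ℤ_[2] (IwasawaAlgebra 2 ⧸ Ideal.span {(PowerSeries.X + 2 : IwasawaAlgebra 2)}) := by
  have hc : (-2 : ℤ_[2]) ∈ IsLocalRing.maximalIdeal ℤ_[2] := by
    rw [PadicInt.maximalIdeal_eq_span_p, Ideal.mem_span_singleton]
    exact ⟨-1, by norm_num⟩
  have he : Ideal.span {(PowerSeries.X - PowerSeries.C (-2 : ℤ_[2]) : IwasawaAlgebra 2)} =
      Ideal.span {(PowerSeries.X + 2 : IwasawaAlgebra 2)} := by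
    rw [map_neg, sub_neg_eq_add, map_ofNat]
  haveI := (IwasawaAlgebra.free_finrank_quotient_X_sub_C 2 hc).2.1
  exact Module.Finite.equiv (Ideal.quotientEquivAlgOfEq ℤ_[2] he).toLinearEquiv

/-- ★★ **The involution split (p = 2): `corank ker((conj_γ)² − 1) = corank ker(conj_γ − 1) + corank ker(conj_γ + 1)` on
`Sel_∞`** for a `ℤ₂`-extension with topological generator `γ` and `X` finitely generated (the three kernels are dual to
`X/ω₁X`, `X/TX`, `X/(T+2)X`, hence have finite `2`-torsion). The exponents are written `2 ^ 1`, `2 ^ 0` to match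
`…SelmerLayerDuality.exists_addEquiv_selmerInvariants_endInvariants` at `n = 1, 0`. (The `Γ`-module reading of
Dokchitser–Dokchitser's `X(E/ℚ(√2)) ≈ X(E/ℚ) ⊕ X(E⁽²⁾/ℚ)`.)
[cite: DokchitserDokchitserAnnals2010, Lemma 4.14] [cite: GreenbergLNM1716, §3 p. 85] -/
theorem zpCorank_endInvariants_sq_sub_one_eq_add (κ : ZpExtension K 2) {γ : Field.absoluteGaloisGroup K}
    (hγ : κ.IsTopGenerator γ) (D : W.SelmerDualData κ γ) [Module.Finite (IwasawaAlgebra 2) D.X] :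
    zpCorank ↥(endInvariants ((W.conjSelmerInfty κ γ) ^ (2 ^ 1) - 1)) 2 =
      zpCorank ↥(endInvariants ((W.conjSelmerInfty κ γ) ^ (2 ^ 0) - 1)) 2 +
        zpCorank ↥(endInvariants (W.conjSelmerInfty κ γ + 1)) 2 := by
  have e1 : (W.conjSelmerInfty κ γ) ^ (2 ^ 1) - 1 = (W.conjSelmerInfty κ γ) ^ 2 - 1 := by rw [pow_one]
  have e0 : (W.conjSelmerInfty κ γ) ^ (2 ^ 0) - 1 = W.conjSelmerInfty κ γ - 1 := by rw [pow_zero, pow_one]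
  have h1 : Finite (↥(endInvariants ((W.conjSelmerInfty κ γ) ^ (2 ^ 1) - 1)))[(2 : ℤ)] :=
    finite_torsionBy_endInvariants_of_smul W κ hγ D ((D.isDualPair W hγ).toDual_omega_smul 1)
      (module_finite_int_quotient_omega 2 1)
  have h0 : Finite (↥(endInvariants ((W.conjSelmerInfty κ γ) ^ (2 ^ 0) - 1)))[(2 : ℤ)] :=
    finite_torsionBy_endInvariants_of_smul W κ hγ D ((D.isDualPair W hγ).toDual_omega_smul 0)
      (module_finite_int_quotient_omega 2 0)
  haveI hB : Finite (↥(endInvariants (W.conjSelmerInfty κ γ + 1)))[(2 : ℤ)] :=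
    finite_torsionBy_endInvariants_of_smul W κ hγ D (toDual_X_add_two_smul W κ hγ D) module_finite_int_quotient_X_add_two
  rw [e1] at h1 ⊢
  rw [e0] at h0 ⊢
  haveI := h1
  haveI := h0
  exact zpCorank_endInvariants_sq_sub_one_eq_add_of_primary (W.conjSelmerInfty κ γ) fun s ↦ by
    obtain ⟨k, hk⟩ := W.exists_pow_smul_subgroupH1_ker_eq_zero κ (s : W.subgroupH1 2 κ.kerSubgroup)
    exact ⟨k, Subtype.ext (by rw [AddSubgroupClass.coe_nsmul, hk]; rfl)⟩

/-- ★★ **`corank_{ℤ₂} ker(φ + 1) = rank_{ℤ₂} X/(T+2)X`** (`p = 2`, any number field, any `ℤ₂`-extension with topological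
generator, `X` finitely generated): `…SelmerLayerDuality.zpCorank_endInvariants_eq_lambdaInvariant_quotient` at the pair
`(T + 2, φ + 1)`, `Λ/(T+2)` being `ℤ₂`-free of rank one (`IwasawaAlgebra.free_finrank_quotient_X_sub_C`, `−2 ∈ 𝔪`).
[cite: GreenbergLNM1716, §1 pp. 60, 65] [cite: Washington1997, Prop. 13.8] -/
theorem zpCorank_endInvariants_add_one_eq_lambdaInvariant (κ : ZpExtension K 2) {γ : Field.absoluteGaloisGroup K}
    (hγ : κ.IsTopGenerator γ) (D : W.SelmerDualData κ γ) [Module.Finite (IwasawaAlgebra 2) D.X] :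
    zpCorank ↥(endInvariants (W.conjSelmerInfty κ γ + 1)) 2 =
      lambdaInvariant 2 (D.X ⧸ (Ideal.span {(PowerSeries.X + 2 : IwasawaAlgebra 2)} • ⊤ :
        Submodule (IwasawaAlgebra 2) D.X)) := by
  exact zpCorank_endInvariants_eq_lambdaInvariant_quotient 2 W κ hγ D (toDual_X_add_two_smul W κ hγ D)
    module_finite_int_quotient_X_add_two

/-- **`corank_{ℤ_p} ker(φ − 1) = rank_{ℤ_p} X/TX = coinvariantsRank`** (any `p`; the pair `(T, φ − 1)` is the dual datum itself).
[cite: GreenbergLNM1716, §1 pp. 60, 65] -/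
theorem zpCorank_endInvariants_sub_one_eq_coinvariantsRank (hγ : κ.IsTopGenerator γ) (D : W.SelmerDualData κ γ)
    [Module.Finite (IwasawaAlgebra p) D.X] :
    zpCorank ↥(endInvariants ((W.conjSelmerInfty κ γ) ^ (p ^ 0) - 1)) p = IwasawaAlgebra.coinvariantsRank p D.X := by
  have hfin : Module.Finite ℤ_[p] (IwasawaAlgebra p ⧸ Ideal.span {(PowerSeries.X : IwasawaAlgebra p)}) := by
    have he : Ideal.span {(PowerSeries.X - PowerSeries.C (0 : ℤ_[p]) : IwasawaAlgebra p)} =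
        Ideal.span {(PowerSeries.X : IwasawaAlgebra p)} := by rw [map_zero, sub_zero]
    haveI := (IwasawaAlgebra.free_finrank_quotient_X_sub_C p (c := 0) (Submodule.zero_mem _)).2.1
    exact Module.Finite.equiv (Ideal.quotientEquivAlgOfEq ℤ_[p] he).toLinearEquiv
  have hfg : ∀ (x : D.X) (s : W.selmerInfty κ),
      D.toDual ((PowerSeries.X : IwasawaAlgebra p) • x) s = D.toDual x (((W.conjSelmerInfty κ γ) ^ (p ^ 0) - 1) s) :=
    fun x s ↦ by rw [pow_zero, pow_one]; exact (D.isDualPair W hγ).T_smul x s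
  exact zpCorank_endInvariants_eq_lambdaInvariant_quotient p W κ hγ D hfg hfin

/-- ★★ **`corank_{ℤ₂} Sel_∞^{Γ_1} = rank_{ℤ₂} X/TX + rank_{ℤ₂} X/(T+2)X`** — the first layer of a `ℤ₂`-extension splits
along the involution `γ` of `Sel_∞^{γ²}` into the `+1`-part (`= Sel_∞^{Γ_0}`, rank `X/TX`) and the `−1`-part (rank `X/(T+2)X`);
equivalently `rank_{ℤ₂} X/ω₁X = rank_{ℤ₂} X/TX + rank_{ℤ₂} X/(T+2)X` (`ω₁ = T(T+2)`).
[cite: DokchitserDokchitserAnnals2010, Lemma 4.14] [cite: GreenbergLNM1716, §1 p. 65, §3 p. 85] -/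
theorem zpCorank_selmerInvariants_one_eq_coinvariantsRank_add (κ : ZpExtension K 2) {γ : Field.absoluteGaloisGroup K}
    (hγ : κ.IsTopGenerator γ) (D : W.SelmerDualData κ γ) [Module.Finite (IwasawaAlgebra 2) D.X] :
    zpCorank ↥(W.selmerInfty κ ⊓ W.layerInvariants κ 1) 2 =
      IwasawaAlgebra.coinvariantsRank 2 D.X +
        lambdaInvariant 2 (D.X ⧸ (Ideal.span {(PowerSeries.X + 2 : IwasawaAlgebra 2)} • ⊤ :
          Submodule (IwasawaAlgebra 2) D.X)) := by
  obtain ⟨e, -⟩ := exists_addEquiv_selmerInvariants_endInvariants W κ hγ 1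
  rw [zpCorank_congr e 2, zpCorank_endInvariants_sq_sub_one_eq_add W κ hγ D,
    zpCorank_endInvariants_sub_one_eq_coinvariantsRank W κ hγ D, zpCorank_endInvariants_add_one_eq_lambdaInvariant W κ hγ D]

/-- The same with the layer-`1` quotient on the left: **`rank_{ℤ₂} X/ω₁X = rank_{ℤ₂} X/TX + rank_{ℤ₂} X/(T+2)X`**.
[cite: Washington1997, §13.2] [cite: GreenbergLNM1716, §1 p. 65] -/
theorem lambdaInvariant_layerQuotient_one_eq_coinvariantsRank_add (κ : ZpExtension K 2) {γ : Field.absoluteGaloisGroup K}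
    (hγ : κ.IsTopGenerator γ) (D : W.SelmerDualData κ γ) [Module.Finite (IwasawaAlgebra 2) D.X] :
    lambdaInvariant 2 (D.X ⧸ (Ideal.span {((1 + PowerSeries.X : PowerSeries ℤ_[2]) ^ (2 ^ 1) - 1 : IwasawaAlgebra 2)} • ⊤ :
        Submodule (IwasawaAlgebra 2) D.X)) =
      IwasawaAlgebra.coinvariantsRank 2 D.X +
        lambdaInvariant 2 (D.X ⧸ (Ideal.span {(PowerSeries.X + 2 : IwasawaAlgebra 2)} • ⊤ :
          Submodule (IwasawaAlgebra 2) D.X)) := by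
  rw [← zpCorank_selmerInvariants_eq_lambdaInvariant_layerQuotient 2 W κ hγ D 1]
  exact zpCorank_selmerInvariants_one_eq_coinvariantsRank_add W κ hγ D

end SplitTwo

/-! ## §2 Over `ℚ`: the two-sided matching modulo the layer-1 cokernel -/

section Matching

variable (W : WeierstrassCurve ℚ) [W.IsElliptic] [W.IsGloballyMinimal] {κ : ZpExtension ℚ 2}
  {γ : Field.absoluteGaloisGroup ℚ}

/-- ★★ **`corank_{ℤ₂} Sel_{2^∞}(W⁽²⁾/ℚ) ≤ rank_{ℤ₂} X/(T+2)X`, UNCONDITIONALLY** (`W/ℚ` globally minimal, good ordinary at `2`,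
`κ` cyclotomic with topological generator `γ`, any dual datum): Lemma 3.1 at layer `1` gives
`corank Sel₁ ≤ corank Sel_∞^{Γ_1} = rank X/TX + rank X/(T+2)X` (§1), `corank Sel₁ = corank Sel(W/ℚ) + corank Sel(W⁽²⁾/ℚ)` (g39,
Dokchitser–Dokchitser 4.14) and `rank X/TX = corank Sel(W/ℚ)` (layer-`0` control over `ℚ`,
`Greenberg1999_coinvariantsRank_eq_selmerCorank_rat_holds`). In rank currency this is the lineage's one-sided matching
(g38: `(T+2)^{corank Sel(W⁽²⁾)} ∣ f_X`). [cite: GreenbergLNM1716, Thm 1.2, §3 Lemma 3.1] [cite: DokchitserDokchitserAnnals2010, Lemma 4.14] -/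
theorem selmerCorank_quadraticTwist_le_lambdaInvariant_quotient_X_add_two (h2 : IsOrdinaryAt W 2) (hκ : κ.IsCyclotomic)
    (hγ : κ.IsTopGenerator γ) (D : W.SelmerDualData κ γ) :
    (W.quadraticTwist 2).selmerCorank 2 ≤
      lambdaInvariant 2 (D.X ⧸ (Ideal.span {(PowerSeries.X + 2 : IwasawaAlgebra 2)} • ⊤ : Submodule (IwasawaAlgebra 2) D.X)) := by
  haveI : Module.Finite (IwasawaAlgebra 2) D.X := SelmerDualData.module_finite_of_isCyclotomic W κ hκ D hγ
  have h0 : IwasawaAlgebra.coinvariantsRank 2 D.X = W.selmerCorank 2 :=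
    (Greenberg1999_coinvariantsRank_eq_selmerCorank_rat_holds W 2 h2.1 h2.2 κ γ hκ hγ D).2
  have h1 := zpCorank_selmerLayer_le_lambdaInvariant_layerQuotient W κ hγ D 1
  rw [lambdaInvariant_layerQuotient_one_eq_coinvariantsRank_add W κ hγ D, h0, zpCorank_selmerLayer_one_eq_add W hκ] at h1
  omega

/-- ★★★ **THE TWO-SIDED LAYER-ONE MATCHING modulo the layer-1 cokernel: `rank_{ℤ₂} X/(T+2)X = corank_{ℤ₂} Sel_{2^∞}(W⁽²⁾/ℚ)`
as soon as `coker s_1` is finite** (`W/ℚ` globally minimal, good ordinary at `2`, `κ` cyclotomic): control in corank form at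
layer `1` (`…SelmerLayerControl`) + §1 + DD 4.14 + layer-`0` control. [cite: GreenbergLNM1716, Thm 1.2 and §1 p. 65]
[cite: DokchitserDokchitserAnnals2010, Lemma 4.14] -/
theorem lambdaInvariant_quotient_X_add_two_eq_selmerCorank_quadraticTwist_of_finite_cokerS (h2 : IsOrdinaryAt W 2)
    (hκ : κ.IsCyclotomic) (hγ : κ.IsTopGenerator γ) (D : W.SelmerDualData κ γ) [Finite (W.CokerS κ 1)] :
    lambdaInvariant 2 (D.X ⧸ (Ideal.span {(PowerSeries.X + 2 : IwasawaAlgebra 2)} • ⊤ : Submodule (IwasawaAlgebra 2) D.X)) =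
      (W.quadraticTwist 2).selmerCorank 2 := by
  haveI : Module.Finite (IwasawaAlgebra 2) D.X := SelmerDualData.module_finite_of_isCyclotomic W κ hκ D hγ
  have h0 : IwasawaAlgebra.coinvariantsRank 2 D.X = W.selmerCorank 2 :=
    (Greenberg1999_coinvariantsRank_eq_selmerCorank_rat_holds W 2 h2.1 h2.2 κ γ hκ hγ D).2
  have h1 := zpCorank_selmerLayer_eq_lambdaInvariant_layerQuotient_of_finite_cokerS W κ hγ D 1
  rw [lambdaInvariant_layerQuotient_one_eq_coinvariantsRank_add W κ hγ D, h0, zpCorank_selmerLayer_one_eq_add W hκ] at h1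
  omega

/-- ★★★ **The two-sided matching as soon as Greenberg's `ker g_1 = A_1/Sel_1` is finite** — the form whose remaining input is
LOCAL (the local tower kernels `𝒦_{v,1}[2^∞]` at the bad places and at `v = 2`; Lemma 3.3 handles `v ≠ 2` at every layer, so
what remains is Lemma 3.4 at `n = 1`: `ker(H¹(ℚ₂(√2), E) → H¹(ℚ_{2,∞}, E))[2^∞]` finite).
[cite: GreenbergLNM1716, §3 Lemmas 3.3–3.5 (pp. 86–90)] -/
theorem lambdaInvariant_quotient_X_add_two_eq_selmerCorank_quadraticTwist_of_finite_kerG (h2 : IsOrdinaryAt W 2)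
    (hκ : κ.IsCyclotomic) (hγ : κ.IsTopGenerator γ) (D : W.SelmerDualData κ γ) [Finite (W.KerG κ 1)] :
    lambdaInvariant 2 (D.X ⧸ (Ideal.span {(PowerSeries.X + 2 : IwasawaAlgebra 2)} • ⊤ : Submodule (IwasawaAlgebra 2) D.X)) =
      (W.quadraticTwist 2).selmerCorank 2 := by
  haveI := finite_cokerS_of_finite_kerG W κ 1
  exact lambdaInvariant_quotient_X_add_two_eq_selmerCorank_quadraticTwist_of_finite_cokerS W h2 hκ hγ D

/-! ## §3 The matching modulo the named print fact (Greenberg's Lemma 3.4, `F = ℚ`) -/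

/-- ★★★ **The two-sided layer-one matching modulo Greenberg's Lemma 3.4 (`F = ℚ`)**: granted the tree's named fact
`Greenberg1999.lemma34_natCard_localTowerKerPrimary_eq_rat` (LNM 1716, Lemma 3.4, p. 89: `#ker(r_{v_n}) = #Ẽ(𝔽_p)(p)²` at every
layer), Mazur's control theorem holds over `ℚ` (`selmer_control_of_lemma34`), `coker s_1` is finite, and
**`rank_{ℤ₂} X/(T+2)X = corank_{ℤ₂} Sel_{2^∞}(W⁽²⁾/ℚ)`** for every globally minimal `W/ℚ` good ordinary at `2`. CONDITIONAL on
that named fact (displayed hypothesis `h34`); the unconditional half is `selmerCorank_quadraticTwist_le_lambdaInvariant_quotient_X_add_two`.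
[cite: GreenbergLNM1716, Thm 1.2 and §3 Lemma 3.4 (p. 89)] [cite: DokchitserDokchitserAnnals2010, Lemma 4.14] -/
theorem lambdaInvariant_quotient_X_add_two_eq_selmerCorank_quadraticTwist_of_lemma34
    (h34 : Greenberg1999.lemma34_natCard_localTowerKerPrimary_eq_rat) (h2 : IsOrdinaryAt W 2) (hκ : κ.IsCyclotomic)
    (hγ : κ.IsTopGenerator γ) (D : W.SelmerDualData κ γ) :
    lambdaInvariant 2 (D.X ⧸ (Ideal.span {(PowerSeries.X + 2 : IwasawaAlgebra 2)} • ⊤ : Submodule (IwasawaAlgebra 2) D.X)) =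
      (W.quadraticTwist 2).selmerCorank 2 := by
  obtain ⟨B, hB⟩ := W.selmer_control_of_lemma34 κ h34 hκ (W.hasGoodReductionAt_and_hasUnitRootAt_of_rat h2.1 h2.2)
  haveI : Finite (W.CokerS κ 1) := (hB 1).2.2.1
  exact lambdaInvariant_quotient_X_add_two_eq_selmerCorank_quadraticTwist_of_finite_cokerS W h2 hκ hγ D

end Matching

end Summit.BirchSwinnertonDyer.BirchSwinnertonDyer.Theorems.AlignedTransportAtTwoSelmerLayerTwoSidedMatching

end
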